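import Mathlib
import Summits.Ventures.PercRepro2.CrossAPrimeExploredBound

/-!
# The coin at a mark, I: the type split of the `a₂`-side step along `e = {a₂, o}`
(blind cell PercRepro2, p5 g38; `proofs/subclaims/S4-HARDSTEP.md` §2.4 (s) addendum 46 (3))

Let `e = {a₂, o}` be a coin (a random edge at `a₂`) and `p⁰ = p[e ↦ 0]`, `p¹ = p[e ↦ 1]`.  Under
`p¹` the mark `o` is in `K = C(a₂)` surely, so the `o`-masses collapse (`coin_mark_oH_masses`).
Split the configurations by the TYPE of the cluster with the coin closed: type 1 = `o ∈ K⁰`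
(the flip of `e` changes no connection, `conn_update_true_iff_of_conn`), type 2 = `o ∉ K⁰`
(the clusters grown through the coin).  Then every `p¹`-mass is the corresponding `p⁰`-mass
with `o ∈ K` plus its type-2 part (`prob_update_one_split`), and the middle coefficient of the
one-edge quadratic along `e` is EXACTLY

  `Φ₀₁ + Φ₁₀ = crossC(p⁰; c) + x⁰·Dv⁰ + t⁰·(c·x⁰ − xv⁰) + CROSS`      (**`coin_mark_mid_eq`**)

with `t⁰ = P⁰(Q, oH, bH)` and
`CROSS = y₂′·(c·x⁰ − xv⁰) + y⁰·(c·Z₂′ − Zv₂′) + yv₂′·(2Z⁰ − x⁰) + Z₂′·(2Dv⁰ − yv⁰)` on the type-2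
masses `Z₂′ = P¹(Q, type 2)`, `y₂′ = P¹(Q, bH, type 2)`, `Zv₂′ = P¹(Q, vL, type 2)`,
`yv₂′ = P¹(Q, vL, bH, type 2)`.  The signs are in `CrossAPrimeCoinMark` (part II).  Own work;
standard axioms.
-/

namespace Summit.Ventures.PercRepro2

open LeafRowPendantRootSO CrossAPrimeSupport CrossAPrimeA2Route CrossAPrimeA2Induction
  CrossAPrimeExploredBound

namespace CrossAPrimeCoinMark

section Flip

variable {V : Type*} {E : Type*} [DecidableEq E] {ends : E → Sym2 V}

/-- **Opening an edge whose endpoints are already connected changes no connection.** -/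
lemma conn_update_true_iff_of_conn {e : E} {u w : V} (hends : ends e = s(u, w)) {ω : Config E}
    (huw : Conn ends (Function.update ω e false) u w) (s x : V) :
    Conn ends (Function.update ω e true) s x ↔ Conn ends (Function.update ω e false) s x := by
  have h := OneEdge.conn_update_true_iff hends (Function.update ω e false) s x
  rw [Function.update_idem] at h
  rw [h]
  constructor
  · rintro (h | ⟨h₁, h₂⟩ | ⟨h₁, h₂⟩)
    · exact h
    · exact conn_trans (conn_trans h₁ huw) h₂
    · exact conn_trans (conn_trans h₁ (conn_symm huw)) h₂
  · exact Or.inl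

/-- The flip of `e = {a₂, o}` is invisible to `Q = {a₂ ↮ a₁}` when `o ∈ K⁰`. -/
lemma flip_avoidAll_iff {e : E} {a₂ o : V} (hends : ends e = s(a₂, o)) {ω : Config E}
    (ho : Conn ends (Function.update ω e false) a₂ o) (X : Finset V) :
    Function.update ω e true ∈ avoidAll ends a₂ X ↔
      Function.update ω e false ∈ avoidAll ends a₂ X := by
  simp only [mem_avoidAll, conn_update_true_iff_of_conn hends ho]

/-- The flip of `e = {a₂, o}` is invisible to every connection event when `o ∈ K⁰`. -/
lemma flip_connEvent_iff {e : E} {a₂ o : V} (hends : ends e = s(a₂, o)) {ω : Config E}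
    (ho : Conn ends (Function.update ω e false) a₂ o) (s x : V) :
    Function.update ω e true ∈ connEvent ends s x ↔
      Function.update ω e false ∈ connEvent ends s x :=
  conn_update_true_iff_of_conn hends ho s x

/-- The flip-invariance of the four mass events (`Q`, `Q ∩ bH`, `Q ∩ vL`, `Q ∩ vL ∩ bH`). -/
lemma flip_mass_events {e : E} {a₂ o : V} (hends : ends e = s(a₂, o)) (a₁ v b : V) :
    (∀ ω : Config E, Conn ends (Function.update ω e false) a₂ o →
      (Function.update ω e true ∈ avoidAll ends a₂ {a₁} ↔
        Function.update ω e false ∈ avoidAll ends a₂ {a₁})) ∧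
    (∀ ω : Config E, Conn ends (Function.update ω e false) a₂ o →
      (Function.update ω e true ∈ avoidAll ends a₂ {a₁} ∩ connEvent ends a₂ b ↔
        Function.update ω e false ∈ avoidAll ends a₂ {a₁} ∩ connEvent ends a₂ b)) ∧
    (∀ ω : Config E, Conn ends (Function.update ω e false) a₂ o →
      (Function.update ω e true ∈ avoidAll ends a₂ {a₁} ∩ connEvent ends a₁ v ↔
        Function.update ω e false ∈ avoidAll ends a₂ {a₁} ∩ connEvent ends a₁ v)) ∧
    (∀ ω : Config E, Conn ends (Function.update ω e false) a₂ o →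
      (Function.update ω e true ∈
          avoidAll ends a₂ {a₁} ∩ (connEvent ends a₁ v ∩ connEvent ends a₂ b) ↔
        Function.update ω e false ∈
          avoidAll ends a₂ {a₁} ∩ (connEvent ends a₁ v ∩ connEvent ends a₂ b))) := by
  refine ⟨fun ω ho => flip_avoidAll_iff hends ho _, fun ω ho => ?_, fun ω ho => ?_,
    fun ω ho => ?_⟩
  · simp only [Set.mem_inter_iff, flip_avoidAll_iff hends ho, flip_connEvent_iff hends ho]
  · simp only [Set.mem_inter_iff, flip_avoidAll_iff hends ho, flip_connEvent_iff hends ho]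
  · simp only [Set.mem_inter_iff, flip_avoidAll_iff hends ho, flip_connEvent_iff hends ho]

end Flip

section Split

variable {V : Type*} {E : Type*} [Fintype E] [DecidableEq E] {R : Type*} [Field R]
variable {ends : E → Sym2 V}

/-- **The type-1 part of a `p¹`-mass is the `p⁰`-mass with `o ∈ K`**: for a flip-invariant event
`A`, `P¹(A, o ∈ K⁰) = P⁰(A, oH)`. -/
lemma prob_update_one_inter_type1 (p : E → R) {e : E} {a₂ o : V}
    {A : Set (Config E)} (hA : ∀ ω : Config E, Conn ends (Function.update ω e false) a₂ o →
      (Function.update ω e true ∈ A ↔ Function.update ω e false ∈ A)) :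
    prob (Function.update p e 1)
        (A ∩ {ω | o ∉ cluster ends (Function.update ω e false) a₂}ᶜ) =
      prob (Function.update p e 0) (A ∩ connEvent ends a₂ o) := by
  rw [RBRootEdge.prob_update_one_eq, RBRootEdge.prob_update_zero_eq]
  congr 1
  ext ω
  simp only [Set.mem_setOf_eq, Set.mem_inter_iff, Set.mem_compl_iff, Function.update_idem,
    not_not, mem_cluster]
  constructor
  · rintro ⟨hA', ho⟩
    exact ⟨(hA ω ho).1 hA', ho⟩
  · rintro ⟨hA', ho⟩
    exact ⟨(hA ω ho).2 hA', ho⟩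

/-- **The type split of a `p¹`-mass**: `P¹(A) = P⁰(A, oH) + P¹(A, type 2)`. -/
lemma prob_update_one_split (p : E → R) {e : E} {a₂ o : V}
    {A : Set (Config E)} (hA : ∀ ω : Config E, Conn ends (Function.update ω e false) a₂ o →
      (Function.update ω e true ∈ A ↔ Function.update ω e false ∈ A)) :
    prob (Function.update p e 1) A =
      prob (Function.update p e 0) (A ∩ connEvent ends a₂ o) +
        prob (Function.update p e 1)
          (A ∩ {ω | o ∉ cluster ends (Function.update ω e false) a₂}) := by
  rw [← prob_update_one_inter_type1 p hA, add_comm,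
    prob_inter_add_prob_inter_compl]

/-- Under `p[e ↦ 1]` with `e = {a₂, o}`, the event `{o ∈ K}` is sure: `P¹(S ∩ oH) = P¹(S)`. -/
lemma prob_update_one_inter_oH (p : E → R) {e : E} {a₂ o : V} (hends : ends e = s(a₂, o))
    (S : Set (Config E)) :
    prob (Function.update p e 1) (S ∩ connEvent ends a₂ o) = prob (Function.update p e 1) S := by
  rw [← prob_update_one_inter_openEdge p S e,
    ← prob_update_one_inter_openEdge p (S ∩ connEvent ends a₂ o) e]
  congr 1
  ext ω
  simp only [Set.mem_inter_iff, openEdge, Set.mem_setOf_eq]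
  constructor
  · rintro ⟨⟨hS, -⟩, he⟩
    exact ⟨hS, he⟩
  · rintro ⟨hS, he⟩
    exact ⟨⟨hS, conn_of_openAdj ⟨e, he, hends⟩⟩, he⟩

end Split

section Masses

variable {V : Type*} {E : Type*} [Fintype E] [DecidableEq E] [Fintype V] [DecidableEq V]
  {R : Type*} [Field R] [LinearOrder R] [IsStrictOrderedRing R]
variable {ends : E → Sym2 V}

omit [Fintype V] [DecidableEq V] [LinearOrder R] [IsStrictOrderedRing R] in
/-- **The collapse of the `o`-masses under `p¹`**: `x¹ = Z¹`, `xv¹ = Zv¹`, `Dv¹ = yv¹`. -/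
lemma coin_mark_oH_masses (p : E → R) {e : E} {a₂ o : V} (hends : ends e = s(a₂, o))
    (a₁ v b : V) :
    prob (Function.update p e 1) (avoidAll ends a₂ {a₁} ∩ connEvent ends a₂ o) =
        prob (Function.update p e 1) (avoidAll ends a₂ {a₁}) ∧
      prob (Function.update p e 1)
          (avoidAll ends a₂ {a₁} ∩ (connEvent ends a₁ v ∩ connEvent ends a₂ o)) =
        prob (Function.update p e 1) (avoidAll ends a₂ {a₁} ∩ connEvent ends a₁ v) ∧
      prob (Function.update p e 1) (avoidAll ends a₂ {a₁} ∩
          (connEvent ends a₁ v ∩ (connEvent ends a₂ o ∩ connEvent ends a₂ b))) =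
        prob (Function.update p e 1)
          (avoidAll ends a₂ {a₁} ∩ (connEvent ends a₁ v ∩ connEvent ends a₂ b)) := by
  refine ⟨prob_update_one_inter_oH p hends _, ?_, ?_⟩
  · rw [← Set.inter_assoc]
    exact prob_update_one_inter_oH p hends _
  · have h1 : avoidAll ends a₂ {a₁} ∩ (connEvent ends a₁ v ∩ (connEvent ends a₂ o ∩
        connEvent ends a₂ b)) = (avoidAll ends a₂ {a₁} ∩ (connEvent ends a₁ v ∩
        connEvent ends a₂ b)) ∩ connEvent ends a₂ o := by
      ext ω
      simp only [Set.mem_inter_iff]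
      tauto
    rw [h1]
    exact prob_update_one_inter_oH p hends _

omit [Fintype V] [DecidableEq V] [LinearOrder R] [IsStrictOrderedRing R] in
/-- **The middle coefficient along the coin `e = {a₂, o}`, split by type**: with the `p⁰`-masses
`Z⁰, x⁰, y⁰, t⁰ = P⁰(Q, oH, bH), xv⁰, yv⁰, Dv⁰` and the type-2 masses
`Z₂′ = P¹(Q, type 2)`, `y₂′ = P¹(Q, bH, type 2)`, `Zv₂′ = P¹(Q, vL, type 2)`,
`yv₂′ = P¹(Q, vL, bH, type 2)`,
`Φ₀₁ + Φ₁₀ = crossC(p⁰; c) + x⁰·Dv⁰ + t⁰·(c·x⁰ − xv⁰)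
  + [y₂′·(c·x⁰ − xv⁰) + y⁰·(c·Z₂′ − Zv₂′) + yv₂′·(2Z⁰ − x⁰) + Z₂′·(2Dv⁰ − yv⁰)]`. -/
theorem coin_mark_mid_eq (p : E → R) (c : R) {e : E} {a₂ o : V} (hends : ends e = s(a₂, o))
    (a₁ v b : V) :
    crossPatC (Function.update p e 0) (Function.update p e 1) c ends o a₁ a₂ v b +
        crossPatC (Function.update p e 1) (Function.update p e 0) c ends o a₁ a₂ v b =
      crossC (Function.update p e 0) c ends o a₁ a₂ v b +
        prob (Function.update p e 0) (avoidAll ends a₂ {a₁} ∩ connEvent ends a₂ o) *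
          prob (Function.update p e 0) (avoidAll ends a₂ {a₁} ∩
            (connEvent ends a₁ v ∩ (connEvent ends a₂ o ∩ connEvent ends a₂ b))) +
        prob (Function.update p e 0) ((avoidAll ends a₂ {a₁} ∩ connEvent ends a₂ b) ∩
            connEvent ends a₂ o) *
          (c * prob (Function.update p e 0) (avoidAll ends a₂ {a₁} ∩ connEvent ends a₂ o) -
            prob (Function.update p e 0)
              (avoidAll ends a₂ {a₁} ∩ (connEvent ends a₁ v ∩ connEvent ends a₂ o))) +
        (prob (Function.update p e 1) ((avoidAll ends a₂ {a₁} ∩ connEvent ends a₂ b) ∩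
              {ω | o ∉ cluster ends (Function.update ω e false) a₂}) *
            (c * prob (Function.update p e 0) (avoidAll ends a₂ {a₁} ∩ connEvent ends a₂ o) -
              prob (Function.update p e 0)
                (avoidAll ends a₂ {a₁} ∩ (connEvent ends a₁ v ∩ connEvent ends a₂ o))) +
          prob (Function.update p e 0) (avoidAll ends a₂ {a₁} ∩ connEvent ends a₂ b) *
            (c * prob (Function.update p e 1) (avoidAll ends a₂ {a₁} ∩
                {ω | o ∉ cluster ends (Function.update ω e false) a₂}) -
              prob (Function.update p e 1) ((avoidAll ends a₂ {a₁} ∩ connEvent ends a₁ v) ∩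
                {ω | o ∉ cluster ends (Function.update ω e false) a₂})) +
          prob (Function.update p e 1)
              ((avoidAll ends a₂ {a₁} ∩ (connEvent ends a₁ v ∩ connEvent ends a₂ b)) ∩
                {ω | o ∉ cluster ends (Function.update ω e false) a₂}) *
            (2 * prob (Function.update p e 0) (avoidAll ends a₂ {a₁}) -
              prob (Function.update p e 0) (avoidAll ends a₂ {a₁} ∩ connEvent ends a₂ o)) +
          prob (Function.update p e 1) (avoidAll ends a₂ {a₁} ∩
              {ω | o ∉ cluster ends (Function.update ω e false) a₂}) *
            (2 * prob (Function.update p e 0) (avoidAll ends a₂ {a₁} ∩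
                (connEvent ends a₁ v ∩ (connEvent ends a₂ o ∩ connEvent ends a₂ b))) -
              prob (Function.update p e 0)
                (avoidAll ends a₂ {a₁} ∩ (connEvent ends a₁ v ∩ connEvent ends a₂ b)))) := by
  obtain ⟨hQ, hQb, hQv, hQvb⟩ := flip_mass_events hends a₁ v b
  obtain ⟨h1, h2, h3⟩ := coin_mark_oH_masses p hends a₁ v b
  have sQ := prob_update_one_split p hQ
  have sQb := prob_update_one_split p hQb
  have sQv := prob_update_one_split p hQv
  have sQvb := prob_update_one_split p hQvb
  unfold crossPatC crossC
  rw [h1, h2, h3, sQ, sQb, sQv, sQvb]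
  have e1 : avoidAll ends a₂ {a₁} ∩ connEvent ends a₁ v ∩ connEvent ends a₂ o =
      avoidAll ends a₂ {a₁} ∩ (connEvent ends a₁ v ∩ connEvent ends a₂ o) := by
    rw [Set.inter_assoc]
  have e2 : avoidAll ends a₂ {a₁} ∩ (connEvent ends a₁ v ∩ connEvent ends a₂ b) ∩
      connEvent ends a₂ o = avoidAll ends a₂ {a₁} ∩
      (connEvent ends a₁ v ∩ (connEvent ends a₂ o ∩ connEvent ends a₂ b)) := by
    ext ω
    simp only [Set.mem_inter_iff]
    tauto
  rw [e1, e2]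
  ring

end Masses

end CrossAPrimeCoinMark

end Summit.Ventures.PercRepro2
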